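import Summits.AtomisticToContinuum.FouriersLaw.Theorems.HiddenChargeMazurNoOddChargeOrthogonality
import Summits.AtomisticToContinuum.FouriersLaw.Theorems.OddSectorIrreversibilityTapLeakBoundFloorLocalMoments

/-!
# `TapLeakBound` (stmt-AtomisticToContinuum-15159), line `SketchIdeator2`, third floor program: moment growth

Helper file (`--supports stmt-AtomisticToContinuum-15159`) for crux
P = `Summit.AtomisticToContinuum.FouriersLaw.Theses.OddSectorIrreversibility.TapLeakBound`, registered sub-stub
`stub_floorMomentGrowth`: **quantitative `N`-UNIFORM even moments of single coordinates** of the pinned anharmonic chain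
`pinnedChain ω₂ lam β γ` (`ω₂ > 0`, `lam, β ≥ 0`, `T > 0`) under the unnormalised Gibbs weight `μ_T = e^{-H/T} dq dp`
(`gibbsWeight`, mass `Z = ∫ e^{-H/T}`): there is ONE constant `K = K(ω₂, T, C₁) > 0` with
`∫ q_i^{2m} dμ_T ≤ K^m (m!)² Z` and `∫ p_i^{2m} dμ_T ≤ K^m (m!)² Z` for ALL `m`, ALL `N` and all sites `i`.

Route: the induction step `moment_step` of `…SubBallisticWindowGibbsMoments.lean` (Poincaré inequality
`…GibbsPoincare.stub_gibbsPoincare` with constant `κ = T / min(ω₂,1)` applied to `G = π^{m+1}`, `π ∈ {q_i, p_i}`: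
`∫ π^{2m+2} dμ = Var_μ(π^{m+1}) + (∫ π^{m+1} dμ)²/Z ≤ κ (m+1)² ∫ π^{2m} dμ + (∫ π^{m+1} dμ)²/Z`) with the mean term now
bounded by CAUCHY–SCHWARZ, `(∫ π^m · π dμ)² ≤ (∫ π^{2m} dμ)(∫ π² dμ) ≤ C_m Z · C₁ Z` (the landed
`NoOddCharge.sq_integral_mul_le` of `…HiddenChargeMazurNoOddChargeOrthogonality.lean`; `moment_step_cs`), so that
`C_{m+1} = (κ (m+1)² + C₁) C_m ≤ K (m+1)² C_m` with `K = κ + C₁`, whence `C_m ≤ K^m (m!)²` (`stub_floorMomentGrowth`;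
`C₁` is the `N`-uniform second-moment constant of `GibbsMoments.stub_gibbsMoments` at `m = 1`, clipped to `≥ 0`).
References: folklore (Poincaré/Brascamp–Lieb type moment recursion). Nothing here closes the item.
-/

noncomputable section

open MeasureTheory ProbabilityTheory Filter Topology Set Function
open scoped NNReal ENNReal

namespace Summit.AtomisticToContinuum.FouriersLaw.Theorems.OddSectorIrreversibility.TapLeak

open Literature.MathematicalPhysics.KineticTheory.HeatConduction
open Literature.MathematicalPhysics.KineticTheory
open Summit.AtomisticToContinuum.FouriersLaw.Theorems.OddSectorWitness
open Summit.AtomisticToContinuum.FouriersLaw.Theorems.SubBallisticWindow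
open Summit.AtomisticToContinuum.FouriersLaw.Theorems.SubBallisticWindow.GibbsMoments

/-! ### The induction step with the Cauchy–Schwarz mean bound -/

section Pinned

variable {ω₂ lam β : ℝ} (γ : ℝ) (N : ℕ) {T : ℝ} {μ : Measure (PhaseSpace N)} {Z : ℝ}

/-- **Induction step for the even moments of a coordinate, quantitative form.** Let `π` be a `C¹` observable
with `|π| ≤ A(1+H)` and `‖∇ π^{m+1}‖² = (m+1)² π^{2m}` (a single phase-space coordinate). If the Gibbs weight
`μ` satisfies the Poincaré inequality with constant `T / min(ω₂,1)`, `∫ π^{2m} dμ ≤ C Z` and `∫ π² dμ ≤ C₁ Z`,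
then `∫ π^{2m+2} dμ ≤ ((T / min(ω₂,1)) (m+1)² + C₁) C Z`:
`∫ π^{2m+2} = ∫ (π^{m+1} - c)² dμ + c² Z` with `c = (∫ π^{m+1} dμ)/Z`, the Poincaré inequality for the
variance, and Cauchy–Schwarz `(∫ π^{m+1} dμ)² = (∫ π^m · π dμ)² ≤ (∫ π^{2m} dμ)(∫ π² dμ) ≤ C C₁ Z²` for the mean.
[folklore] -/
theorem moment_step_cs (hω : 0 < ω₂) (hl : 0 ≤ lam) (hβ : 0 ≤ β) (hT : 0 < T)
    (hμ : μ = volume.withDensity fun x : PhaseSpace N =>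
      ENNReal.ofReal (Real.exp (-((pinnedChain ω₂ lam β γ).hamiltonian N x) / T)))
    (hZ : Z = ∫ x : PhaseSpace N, Real.exp (-((pinnedChain ω₂ lam β γ).hamiltonian N x) / T))
    (hP : ∀ G : PhaseSpace N → ℝ, ContDiff ℝ 1 G → MemLp G 2 μ →
      Integrable (fun x => ∑ j : Fin N, ((partialQ j G x) ^ 2 + (partialP j G x) ^ 2)) μ →
      ∫ x, (G x - (∫ y, G y ∂μ) / Z) ^ 2 ∂μ ≤
        T / min ω₂ 1 * ∫ x, (∑ j : Fin N, ((partialQ j G x) ^ 2 + (partialP j G x) ^ 2)) ∂μ)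
    {π : PhaseSpace N → ℝ} (hπd : ContDiff ℝ 1 π) {A : ℝ}
    (hπH : ∀ x, |π x| ≤ A * (1 + (pinnedChain ω₂ lam β γ).hamiltonian N x)) {m : ℕ}
    (hgrad : ∀ x, ∑ j : Fin N, ((partialQ j (fun y => π y ^ (m + 1)) x) ^ 2 +
        (partialP j (fun y => π y ^ (m + 1)) x) ^ 2) = ((m : ℝ) + 1) ^ 2 * π x ^ (2 * m))
    {C C₁ : ℝ} (hC : ∫ x, π x ^ (2 * m) ∂μ ≤ C * Z) (hC₁ : ∫ x, π x ^ 2 ∂μ ≤ C₁ * Z) :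
    ∫ x, π x ^ (2 * (m + 1)) ∂μ ≤ (T / min ω₂ 1 * ((m : ℝ) + 1) ^ 2 + C₁) * C * Z := by
  have hK0 : 0 ≤ T / min ω₂ 1 := div_nonneg hT.le (le_min hω.le zero_le_one)
  have hZ' : Z = ∫ x, (pinnedChain ω₂ lam β γ).gibbsDensity N T x := hZ
  have hZpos : 0 < Z := by
    rw [hZ']
    exact integral_exp_pos (pinnedChain_integrable_gibbsDensity hω hl hβ γ N hT)
  have hint : ∀ k : ℕ, Integrable (fun x => π x ^ k) μ :=
    integrable_pow_gibbs γ N hω hl hβ hT hμ hπd.continuous hπH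
  have hI0 : 0 ≤ ∫ x, π x ^ (2 * m) ∂μ := integral_nonneg fun x => (even_two_mul m).pow_nonneg (π x)
  have hI2 : 0 ≤ ∫ x, π x ^ 2 ∂μ := integral_nonneg fun x => sq_nonneg (π x)
  -- constants
  have hconst : ∀ c : ℝ, ∫ _x, c ∂μ = c * Z := fun c => by
    rw [integral_gibbs γ N hμ, integral_const_mul, ← hZ']
  have hconst_int : ∀ c : ℝ, Integrable (fun _ : PhaseSpace N => c) μ := fun c => by
    rw [integrable_gibbs_iff γ N hμ]
    exact (pinnedChain_integrable_gibbsDensity hω hl hβ γ N hT).const_mul c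
  -- the test function `G = π^{m+1}` in the Poincaré inequality
  have hG1 : ContDiff ℝ 1 (fun y => π y ^ (m + 1)) := hπd.pow (m + 1)
  have hGsq : ∀ x, (π x ^ (m + 1)) ^ 2 = π x ^ (2 * (m + 1)) := fun x => by ring
  have hGmem : MemLp (fun y => π y ^ (m + 1)) 2 μ := by
    rw [memLp_two_iff_integrable_sq (hπd.continuous.fun_pow (m + 1)).aestronglyMeasurable]
    exact (hint (2 * (m + 1))).congr (Eventually.of_forall fun x => (hGsq x).symm)
  have hgrad_eq : (fun x => ∑ j : Fin N, ((partialQ j (fun y => π y ^ (m + 1)) x) ^ 2 +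
      (partialP j (fun y => π y ^ (m + 1)) x) ^ 2)) = fun x => ((m : ℝ) + 1) ^ 2 * π x ^ (2 * m) :=
    funext hgrad
  have hgrad_int : Integrable (fun x => ∑ j : Fin N, ((partialQ j (fun y => π y ^ (m + 1)) x) ^ 2 +
      (partialP j (fun y => π y ^ (m + 1)) x) ^ 2)) μ := by
    rw [hgrad_eq]
    exact (hint _).const_mul _
  have hPI : ∫ x, (π x ^ (m + 1) - (∫ y, π y ^ (m + 1) ∂μ) / Z) ^ 2 ∂μ ≤
      T / min ω₂ 1 * ∫ x, (∑ j : Fin N, ((partialQ j (fun y => π y ^ (m + 1)) x) ^ 2 +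
        (partialP j (fun y => π y ^ (m + 1)) x) ^ 2)) ∂μ := hP _ hG1 hGmem hgrad_int
  rw [hgrad_eq, integral_const_mul] at hPI
  obtain ⟨I1, hI1⟩ : ∃ I1 : ℝ, ∫ y, π y ^ (m + 1) ∂μ = I1 := ⟨_, rfl⟩
  rw [hI1] at hPI
  -- expansion of the variance
  have hvar : ∫ x, (π x ^ (m + 1) - I1 / Z) ^ 2 ∂μ = (∫ x, π x ^ (2 * (m + 1)) ∂μ) - I1 ^ 2 / Z := by
    have h1 : ∀ x, (π x ^ (m + 1) - I1 / Z) ^ 2 =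
        (π x ^ (2 * (m + 1)) - (2 * (I1 / Z)) * π x ^ (m + 1)) + (I1 / Z) ^ 2 := fun x => by ring
    simp_rw [h1]
    rw [integral_add ((hint _).sub' ((hint _).const_mul _)) (hconst_int _),
      integral_sub (hint _) ((hint _).const_mul _), integral_const_mul, hI1, hconst]
    have hZne : Z ≠ 0 := hZpos.ne'
    field_simp
    ring
  -- the mean term, by Cauchy–Schwarz
  have hmean : I1 ^ 2 / Z ≤ C₁ * C * Z := by
    have hf2 : Integrable (fun x => (π x ^ m) ^ 2) μ :=
      (hint (2 * m)).congr (Eventually.of_forall fun x => pow_mul' (π x) 2 m)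
    have hfg : Integrable (fun x => π x ^ m * π x) μ :=
      (hint (m + 1)).congr (Eventually.of_forall fun x => pow_succ (π x) m)
    have hcs := NoOddCharge.sq_integral_mul_le μ hf2 (hint 2) hfg
    have e1 : ∫ x, π x ^ m * π x ∂μ = I1 := by
      rw [← hI1]
      exact integral_congr_ae (Eventually.of_forall fun x => (pow_succ (π x) m).symm)
    have e2 : ∫ x, (π x ^ m) ^ 2 ∂μ = ∫ x, π x ^ (2 * m) ∂μ :=
      integral_congr_ae (Eventually.of_forall fun x => (pow_mul' (π x) 2 m).symm)
    rw [e1, e2] at hcs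
    have h2 : I1 ^ 2 ≤ (C * Z) * (C₁ * Z) := hcs.trans (mul_le_mul hC hC₁ hI2 (hI0.trans hC))
    calc I1 ^ 2 / Z ≤ (C * Z) * (C₁ * Z) / Z := div_le_div_of_nonneg_right h2 hZpos.le
      _ = C₁ * C * Z := by
          rw [mul_div_assoc, mul_div_cancel_right₀ _ hZpos.ne']
          ring
  -- the Poincaré term
  have hstep : T / min ω₂ 1 * (((m : ℝ) + 1) ^ 2 * ∫ x, π x ^ (2 * m) ∂μ) ≤
      T / min ω₂ 1 * ((m : ℝ) + 1) ^ 2 * C * Z := by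
    have h : ((m : ℝ) + 1) ^ 2 * ∫ x, π x ^ (2 * m) ∂μ ≤ ((m : ℝ) + 1) ^ 2 * (C * Z) :=
      mul_le_mul_of_nonneg_left hC (by positivity)
    calc T / min ω₂ 1 * (((m : ℝ) + 1) ^ 2 * ∫ x, π x ^ (2 * m) ∂μ)
        ≤ T / min ω₂ 1 * (((m : ℝ) + 1) ^ 2 * (C * Z)) := mul_le_mul_of_nonneg_left h hK0
      _ = _ := by ring
  calc ∫ x, π x ^ (2 * (m + 1)) ∂μ
      = ∫ x, (π x ^ (m + 1) - I1 / Z) ^ 2 ∂μ + I1 ^ 2 / Z := by linarith [hvar]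
    _ ≤ T / min ω₂ 1 * ((m : ℝ) + 1) ^ 2 * C * Z + C₁ * C * Z := add_le_add (hPI.trans hstep) hmean
    _ = _ := by ring

end Pinned

/-! ### The stub -/

/-- **Sub-goal `stub_floorMomentGrowth`** (registered on the crux item stmt-AtomisticToContinuum-15159, line
`SketchIdeator2`, third floor program): quantitative `N`-uniform even moments of single coordinates under the
unnormalised Gibbs weight `μ_T = e^{-H_N/T} dq dp` of `pinnedChain ω₂ lam β γ` (`ω₂ > 0`, `lam, β ≥ 0`, `T > 0`):
there is `K > 0` (here `K = T / min(ω₂,1) + max(C₁, 0)`, `C₁` the `N`-uniform second-moment constant of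
`GibbsMoments.stub_gibbsMoments` fed with `GibbsPoincare.stub_gibbsPoincare`) with
`∫ q_i^{2m} dμ_T ≤ K^m (m!)² Z` and `∫ p_i^{2m} dμ_T ≤ K^m (m!)² Z` for all `m`, all `N` and all sites `i`
(`Z = ∫ e^{-H_N/T}`). Proof: induction on `m` through `moment_step_cs`, using
`(κ (m+1)² + C₁) K^m (m!)² ≤ K^{m+1} ((m+1)!)²`. [folklore] -/
theorem stub_floorMomentGrowth : ∀ (ω₂ lam β γ : ℝ), 0 < ω₂ → 0 ≤ lam → 0 ≤ β → ∀ (T : ℝ), 0 < T → ∃ K : ℝ, 0 < K ∧ ∀ (m N : ℕ) (i : Fin N), ∫ x, (x.1 i) ^ (2 * m) ∂(gibbsWeight ω₂ lam β γ N T) ≤ K ^ m * ((m.factorial : ℝ)) ^ 2 * ∫ x, Real.exp (-((pinnedChain ω₂ lam β γ).hamiltonian N x) / T) ∂MeasureTheory.volume ∧ ∫ x, (x.2 i) ^ (2 * m) ∂(gibbsWeight ω₂ lam β γ N T) ≤ K ^ m * ((m.factorial : ℝ)) ^ 2 * ∫ x, Real.exp (-((pinnedChain ω₂ lam β γ).hamiltonian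 N x) / T) ∂MeasureTheory.volume := by
  intro ω₂ lam β γ hω hl hβ T hT
  have hPI := GibbsPoincare.stub_gibbsPoincare ω₂ lam β γ hω hl hβ T hT
  obtain ⟨C₁, hC₁⟩ := GibbsMoments.stub_gibbsMoments ω₂ lam β γ hω hl hβ T hT hPI 1
  have hκ : 0 < T / min ω₂ 1 := div_pos hT (lt_min hω one_pos)
  have hC0 : 0 ≤ max C₁ 0 := le_max_right _ _
  have hKpos : 0 < T / min ω₂ 1 + max C₁ 0 := add_pos_of_pos_of_nonneg hκ hC0
  refine ⟨T / min ω₂ 1 + max C₁ 0, hKpos, fun m N i => ?_⟩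
  have hZ0 : 0 ≤ ∫ x : PhaseSpace N, Real.exp (-((pinnedChain ω₂ lam β γ).hamiltonian N x) / T) ∂volume :=
    integral_nonneg fun x => (Real.exp_pos _).le
  -- the second moments, clipped
  have hq1 : ∫ x, (x.1 i) ^ 2 ∂(gibbsWeight ω₂ lam β γ N T) ≤
      max C₁ 0 * ∫ x, Real.exp (-((pinnedChain ω₂ lam β γ).hamiltonian N x) / T) ∂volume :=
    (hC₁ N i).1.trans (mul_le_mul_of_nonneg_right (le_max_left _ _) hZ0)
  have hp1 : ∫ x, (x.2 i) ^ 2 ∂(gibbsWeight ω₂ lam β γ N T) ≤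
      max C₁ 0 * ∫ x, Real.exp (-((pinnedChain ω₂ lam β γ).hamiltonian N x) / T) ∂volume :=
    (hC₁ N i).2.trans (mul_le_mul_of_nonneg_right (le_max_left _ _) hZ0)
  induction m with
  | zero =>
    have h1 : ∫ _x, (1 : ℝ) ∂(gibbsWeight ω₂ lam β γ N T) =
        ∫ x, Real.exp (-((pinnedChain ω₂ lam β γ).hamiltonian N x) / T) ∂volume := by
      rw [integral_gibbsWeight]
      simp only [mul_one]
    simp only [mul_zero, pow_zero, Nat.factorial_zero, Nat.cast_one, one_pow, one_mul, h1, le_refl, and_self]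
  | succ m ih =>
    obtain ⟨ihq, ihp⟩ := ih
    -- the arithmetic of the constants
    have hm1 : (1 : ℝ) ≤ ((m : ℝ) + 1) ^ 2 := by
      have hm : (1 : ℝ) ≤ (m : ℝ) + 1 := by
        have := Nat.cast_nonneg (α := ℝ) m
        linarith
      nlinarith
    have hcoef : T / min ω₂ 1 * ((m : ℝ) + 1) ^ 2 + max C₁ 0 ≤
        (T / min ω₂ 1 + max C₁ 0) * ((m : ℝ) + 1) ^ 2 := by
      have h : max C₁ 0 * 1 ≤ max C₁ 0 * ((m : ℝ) + 1) ^ 2 := mul_le_mul_of_nonneg_left hm1 hC0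
      nlinarith
    have hfac : (((m + 1).factorial : ℕ) : ℝ) = ((m : ℝ) + 1) * (m.factorial : ℝ) := by
      rw [Nat.factorial_succ]
      push_cast
      ring
    have hX : 0 ≤ (T / min ω₂ 1 + max C₁ 0) ^ m * (m.factorial : ℝ) ^ 2 := by positivity
    have hfin : (T / min ω₂ 1 * ((m : ℝ) + 1) ^ 2 + max C₁ 0) *
        ((T / min ω₂ 1 + max C₁ 0) ^ m * (m.factorial : ℝ) ^ 2) *
          ∫ x, Real.exp (-((pinnedChain ω₂ lam β γ).hamiltonian N x) / T) ∂volume ≤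
        (T / min ω₂ 1 + max C₁ 0) ^ (m + 1) * (((m + 1).factorial : ℕ) : ℝ) ^ 2 *
          ∫ x, Real.exp (-((pinnedChain ω₂ lam β γ).hamiltonian N x) / T) ∂volume := by
      calc (T / min ω₂ 1 * ((m : ℝ) + 1) ^ 2 + max C₁ 0) *
            ((T / min ω₂ 1 + max C₁ 0) ^ m * (m.factorial : ℝ) ^ 2) *
            ∫ x, Real.exp (-((pinnedChain ω₂ lam β γ).hamiltonian N x) / T) ∂volume
          ≤ (T / min ω₂ 1 + max C₁ 0) * ((m : ℝ) + 1) ^ 2 *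
            ((T / min ω₂ 1 + max C₁ 0) ^ m * (m.factorial : ℝ) ^ 2) *
            ∫ x, Real.exp (-((pinnedChain ω₂ lam β γ).hamiltonian N x) / T) ∂volume :=
            mul_le_mul_of_nonneg_right (mul_le_mul_of_nonneg_right hcoef hX) hZ0
        _ = _ := by
            rw [hfac]
            ring
    constructor
    · exact (moment_step_cs γ N hω hl hβ hT (μ := gibbsWeight ω₂ lam β γ N T) rfl rfl (hPI N)
        (π := fun x => x.1 i) ((contDiff_apply ℝ ℝ i).comp contDiff_fst) (abs_position_le hω hl hβ γ N · i)
        (sum_sq_partial_position_pow i m) ihq hq1).trans hfin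
    · exact (moment_step_cs γ N hω hl hβ hT (μ := gibbsWeight ω₂ lam β γ N T) rfl rfl (hPI N)
        (π := fun x => x.2 i) ((contDiff_apply ℝ ℝ i).comp contDiff_snd) (abs_momentum_le hω.le hl hβ γ N · i)
        (sum_sq_partial_momentum_pow i m) ihp hp1).trans hfin

end Summit.AtomisticToContinuum.FouriersLaw.Theorems.OddSectorIrreversibility.TapLeak

end
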